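import Mathlib
import Literature.NumberTheory.GaloisRepresentations.ProjectiveType
import Literature.NumberTheory.GaloisRepresentations.ProjectiveTypeSolvable
import Literature.RepresentationTheory.Semisimple.FiniteFieldDescentAbsIrred
import HarnessLib

/-!
# Two-dimensional representations fixed on traces by a non-trivial character twist are monomial

Topic `NumberTheory/GaloisRepresentations`; namespace
`Literature.NumberTheory.GaloisRepresentations`.
Theorems only: **no definition and no named fact is introduced**.

Setting: a group `Γ`, a field `k`, a homomorphism `r : Γ →* GL₂(k)` and a character
`η : Γ →* kˣ` satisfying the TRACE PREDICATE `tr r(g) = η(g) · tr r(g)` for all `g ∈ Γ` — the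
shadow on traces of "`r ≅ r ⊗ η`" (for a semisimple `r` and `η` quadratic it is equivalent to it
by Brauer–Nesbitt; only the trace form is used).  Write `N := ker η`.  This is the Galois side of
the cuspidality criterion for quadratic base change / the dictionary "dihedral type = monomial =
induced from a quadratic subgroup" (Gelbart, *Three lectures …* (1997), §4.3, Proposition (ii):
"Dihedral type: `σ` is irreducible of the form `Ind_{W_E}^{W_F} θ` …"; Langlands, *Base change
for GL(2)*: `π ≅ π ⊗ η` iff `π` is automorphically induced from the quadratic field of `η`), in the
elementary matrix form needed for residual representations in odd characteristic:

* `trace_eq_zero_of_trace_eq_mul`, `mul_self_eq_smul_one_of_trace_eq_mul`,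
  `trace_mul_self_ne_zero_of_trace_eq_mul`, `mul_self_mem_ker_of_trace_eq_mul`,
  `unitsVal_eq_neg_one_of_trace_eq_mul`, `mul_mem_ker_of_trace_eq_mul` — for `g ∉ N`:
  `tr r(g) = 0`, `r(g)² = -det r(g) · 1` (Cayley–Hamilton), `tr r(g²) = -2 det r(g) ≠ 0` (if
  `2 ≠ 0` in `k`), so `g² ∈ N`, `η(g) = -1`: **`η` is quadratic and `N` has index two**.
* `exists_common_eigenvector_ker_of_trace_eq_mul` — **`r(N)` has a common eigenvector** (`k`
  algebraically closed, `2 ≠ 0`, `η ≠ 1`): otherwise `r(N)` spans `M₂(k)` (Burnside for `GL₂`,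
  `Literature.RepresentationTheory.Semisimple.span_eq_top_of_no_common_eigenvector`,
  Curtis–Reiner (27.4)) and the linear form `X ↦ tr(r(g₀) X)`, `g₀ ∉ N`, which vanishes on `r(N)`
  (`g₀ N ∩ N = ∅`), would vanish at `r(g₀)⁻¹`, where it equals `tr 1 = 2`.
* `exists_conjGL_isDg_isAd_of_trace_eq_mul` — the **MONOMIAL NORMAL FORM**: if moreover `r` has no
  common eigenvector, then for some `P ∈ GL₂(k)` every `P r(n) P⁻¹`, `n ∈ N`, is diagonal and every
  `P r(g) P⁻¹`, `g ∉ N`, is antidiagonal (tree vocabulary `conjGL`, `GL2.IsDg`, `GL2.IsAd` of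
  `ProjectiveTypeSolvable`): the basis is `(v, r(g₀) v)` for a common eigenvector `v` of `r(N)`
  (`exists_mulVec_mulVec_eq_smul_of_forall_mem_ker`, `mulVec_ne_smul_of_trace_eq_mul`,
  `fin_two_sub_ne_zero_of_ne_smul`, `units_inv_mul_mul_apply_of_mulVec_eq`).
* small group-theoretic helpers `inv_mul_mul_mem_ker_unitsHom`, `exists_not_mem_ker_of_ne_one`.

Consequences drawn elsewhere (Summit side, crux `TensorSquareParallel` of route `NonParallelVoid`):
such an `r`, if irreducible with finite image, is of dihedral type (`isDihedralType_of_monomial`)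
with image of order prime to `char k`.

## Mathlib / tree search

Mathlib: `Matrix.GeneralLinearGroup.mkOfDetNeZero`, `Matrix.traceLinearMap`, `LinearMap.mulLeft`,
`Matrix.mulVec_single_one`; no notion of monomial / dihedral-type representation.  Tree: the
converse direction and the twist-with-intertwiner forms are `TwistStableRestrictionReducible`
(`P ρ P⁻¹ = ρ ⊗ χ` ⟹ `ρ|_{ker χ}` reducible, via Schur), `CliffordTwistDichotomy`,
`CliffordInducedPrimeIndex`, `DihedralTypeMonomial(AnyChar)` (dihedral ⟹ monomial); none starts
from the trace predicate alone, which is what residual representations (defined up to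
semisimplification) provide.

## References

* S. Gelbart, *Three lectures on the modularity of `ρ̄_{E,3}` and the Langlands reciprocity
  conjecture*, in *Modular Forms and Fermat's Last Theorem* (1997), Lecture I Rem. 1.3 (1), §4.3
  Prop. (ii). [Gelbart1997]
* C. W. Curtis, I. Reiner, *Representation Theory of Finite Groups and Associative Algebras*
  (1962), (27.4) (Burnside). [CurtisReiner1962]
* A. H. Clifford, *Representations induced in an invariant subgroup*, Ann. of Math. 38 (1937),
  Thm. 1. [Clifford1937]
-/

noncomputable section

open scoped MatrixGroups
open Matrix

namespace Literature.NumberTheory.GaloisRepresentations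

variable {Γ : Type*} [Group Γ] {k : Type*} [Field k]

/-- **Traces vanish off `N = ker η`.**  If `tr r(g) = η(g) · tr r(g)` for all `g` and
`η(g) ≠ 1`, then `tr r(g) = 0`. [folklore] -/
theorem trace_eq_zero_of_trace_eq_mul {r : Γ →* GL (Fin 2) k} {η : Γ →* kˣ}
    (htr : ∀ g, (r g).val.trace = (η g : k) * (r g).val.trace)
    {g : Γ} (hg : g ∉ η.ker) : (r g).val.trace = 0 := by
  have h1 : (η g : k) ≠ 1 := fun h => hg (by rw [MonoidHom.mem_ker]; exact Units.ext h)
  have h2 : (1 - (η g : k)) * (r g).val.trace = 0 := by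
    rw [sub_mul, one_mul, ← htr g, sub_self]
  rcases mul_eq_zero.mp h2 with h | h
  · exact absurd (sub_eq_zero.mp h).symm h1
  · exact h

/-- For `g ∉ ker η`, `r(g)² = -det r(g) · 1` (Cayley–Hamilton for a trace-zero `2 × 2`
matrix, tree `GL2.cayley_hamilton_two`). [folklore] -/
theorem mul_self_eq_smul_one_of_trace_eq_mul {r : Γ →* GL (Fin 2) k} {η : Γ →* kˣ}
    (htr : ∀ g, (r g).val.trace = (η g : k) * (r g).val.trace)
    {g : Γ} (hg : g ∉ η.ker) :
    (r g).val * (r g).val =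
      (-(r g).val.det) • (1 : Matrix (Fin 2) (Fin 2) k) := by
  rw [GL2.cayley_hamilton_two, trace_eq_zero_of_trace_eq_mul htr hg, zero_smul, zero_sub, neg_smul]

/-- For `g ∉ ker η`, `tr r(g²) = -2 det r(g) ≠ 0` when `2 ≠ 0` in `k`. [folklore] -/
theorem trace_mul_self_ne_zero_of_trace_eq_mul (h2 : (2 : k) ≠ 0) {r : Γ →* GL (Fin 2) k}
    {η : Γ →* kˣ}
    (htr : ∀ g, (r g).val.trace = (η g : k) * (r g).val.trace)
    {g : Γ} (hg : g ∉ η.ker) : (r (g * g)).val.trace ≠ 0 := by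
  rw [map_mul, Matrix.GeneralLinearGroup.coe_mul, mul_self_eq_smul_one_of_trace_eq_mul htr hg,
    Matrix.trace_smul, Matrix.trace_one, Fintype.card_fin, smul_eq_mul]
  refine mul_ne_zero (neg_ne_zero.mpr (GL2.det_ne_zero _)) ?_
  exact_mod_cast h2

/-- **Squares lie in `ker η`** (`2 ≠ 0` in `k`): `tr r(g²) ≠ 0` for `g ∉ ker η`, while traces
vanish off `ker η`. [folklore] -/
theorem mul_self_mem_ker_of_trace_eq_mul (h2 : (2 : k) ≠ 0) {r : Γ →* GL (Fin 2) k} {η : Γ →* kˣ}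
    (htr : ∀ g, (r g).val.trace = (η g : k) * (r g).val.trace)
    (g : Γ) : g * g ∈ η.ker := by
  by_cases hg : g ∈ η.ker
  · exact η.ker.mul_mem hg hg
  · by_contra hgg
    exact trace_mul_self_ne_zero_of_trace_eq_mul h2 htr hg (trace_eq_zero_of_trace_eq_mul htr hgg)

/-- **`η` is quadratic**: `η(g) = -1` for every `g ∉ ker η` (`η(g)² = η(g²) = 1`,
`η(g) ≠ 1`). [folklore] -/
theorem unitsVal_eq_neg_one_of_trace_eq_mul (h2 : (2 : k) ≠ 0) {r : Γ →* GL (Fin 2) k} {η : Γ →* kˣ}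
    (htr : ∀ g, (r g).val.trace = (η g : k) * (r g).val.trace)
    {g : Γ} (hg : g ∉ η.ker) : (η g : k) = -1 := by
  have h1 : (η g : k) ≠ 1 := fun h => hg (by rw [MonoidHom.mem_ker]; exact Units.ext h)
  have hsq : (η g : k) * (η g : k) = 1 := by
    have := mul_self_mem_ker_of_trace_eq_mul h2 htr g
    rw [MonoidHom.mem_ker, map_mul] at this
    rw [← Units.val_mul, this, Units.val_one]
  rcases mul_self_eq_one_iff.mp hsq with h | h
  · exact absurd h h1
  · exact h

/-- **`ker η` has index two**: the product of two elements outside `ker η` lies in `ker η`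
(`η = -1` on both). [folklore] -/
theorem mul_mem_ker_of_trace_eq_mul (h2 : (2 : k) ≠ 0) {r : Γ →* GL (Fin 2) k}
    {η : Γ →* kˣ}
    (htr : ∀ g, (r g).val.trace = (η g : k) * (r g).val.trace)
    {g g' : Γ} (hg : g ∉ η.ker) (hg' : g' ∉ η.ker) : g * g' ∈ η.ker := by
  rw [MonoidHom.mem_ker]
  ext
  rw [map_mul, Units.val_mul, unitsVal_eq_neg_one_of_trace_eq_mul h2 htr hg,
    unitsVal_eq_neg_one_of_trace_eq_mul h2 htr hg', Units.val_one]
  ring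

/-- `ker η` is normal: `g⁻¹ n g ∈ ker η` for `n ∈ ker η` (the target `kˣ` is commutative).
[folklore] -/
theorem inv_mul_mul_mem_ker_unitsHom {η : Γ →* kˣ} (g : Γ) {n : Γ} (hn : n ∈ η.ker) :
    g⁻¹ * n * g ∈ η.ker := by
  rw [MonoidHom.mem_ker] at hn ⊢
  rw [map_mul, map_mul, hn, mul_one, map_inv, inv_mul_cancel]

/-- **`r|_{ker η}` has a common eigenvector** (`k` algebraically closed, `2 ≠ 0` in `k`,
`g₀ ∉ ker η`).  Otherwise the matrices `r(n)`, `n ∈ ker η`, span `M₂(k)` (Burnside for `GL₂`,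
tree `span_eq_top_of_no_common_eigenvector`, Curtis–Reiner (27.4)); the linear form
`X ↦ tr(r(g₀) X)` vanishes on them (`tr r(g₀ n) = 0` as `g₀ n ∉ ker η`), hence on `M₂(k)`, but
its value at `r(g₀)⁻¹` is `tr 1 = 2 ≠ 0`. [cite: CurtisReiner1962, (27.4)] -/
theorem exists_common_eigenvector_ker_of_trace_eq_mul [IsAlgClosed k] (h2 : (2 : k) ≠ 0)
    {r : Γ →* GL (Fin 2) k} {η : Γ →* kˣ}
    (htr : ∀ g, (r g).val.trace = (η g : k) * (r g).val.trace)
    {g₀ : Γ} (hg₀ : g₀ ∉ η.ker) :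
    ∃ v : Fin 2 → k, v ≠ 0 ∧
      ∀ n ∈ η.ker, ∃ a : k, (r n).val *ᵥ v = a • v := by
  by_contra hce
  push Not at hce
  set φ : η.ker →* GL (Fin 2) k := r.comp η.ker.subtype with hφ
  have hspan := Literature.RepresentationTheory.Semisimple.span_eq_top_of_no_common_eigenvector
    φ (fun v hv => by
      obtain ⟨n, hn, hne⟩ := hce v hv
      refine ⟨⟨n, hn⟩, fun hmem => ?_⟩
      obtain ⟨a, ha⟩ := Submodule.mem_span_singleton.mp hmem
      exact hne a ha.symm)
  set L : Matrix (Fin 2) (Fin 2) k →ₗ[k] k :=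
    (Matrix.traceLinearMap (Fin 2) k k).comp
      (LinearMap.mulLeft k (r g₀).val) with hL
  have hL0 : ∀ n : η.ker, L (φ n).val = 0 := by
    intro n
    simp only [hL, LinearMap.comp_apply, LinearMap.mulLeft_apply, Matrix.traceLinearMap_apply,
      hφ, MonoidHom.comp_apply, Subgroup.coe_subtype]
    rw [← Matrix.GeneralLinearGroup.coe_mul, ← map_mul]
    refine trace_eq_zero_of_trace_eq_mul htr fun h => hg₀ ?_
    simpa using η.ker.mul_mem h (η.ker.inv_mem n.2)
  have hker : Submodule.span k (Set.range fun n : η.ker => (φ n).val) ≤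
      LinearMap.ker L := by
    rw [Submodule.span_le]
    rintro _ ⟨n, rfl⟩
    exact hL0 n
  rw [hspan, top_le_iff] at hker
  have h1 : ((r g₀)⁻¹).val ∈ LinearMap.ker L := by
    rw [hker]; exact Submodule.mem_top
  rw [LinearMap.mem_ker] at h1
  simp only [hL, LinearMap.comp_apply, LinearMap.mulLeft_apply, Matrix.traceLinearMap_apply] at h1
  rw [← Matrix.GeneralLinearGroup.coe_mul, mul_inv_cancel, Matrix.GeneralLinearGroup.coe_one,
    Matrix.trace_one, Fintype.card_fin] at h1
  exact h2 (by exact_mod_cast h1)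

/-- If `v` is a common eigenvector of `r(ker η)`, so is `r(g₀) v` for any `g₀`
(`r(n) r(g₀) = r(g₀) r(g₀⁻¹ n g₀)` and `ker η` is normal). [folklore] -/
theorem exists_mulVec_mulVec_eq_smul_of_forall_mem_ker {r : Γ →* GL (Fin 2) k} {η : Γ →* kˣ}
    {v : Fin 2 → k}
    (hv : ∀ n ∈ η.ker, ∃ a : k, (r n).val *ᵥ v = a • v) (g₀ : Γ) {n : Γ}
    (hn : n ∈ η.ker) :
    ∃ b : k, (r n).val *ᵥ ((r g₀).val *ᵥ v) =
      b • ((r g₀).val *ᵥ v) := by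
  obtain ⟨b, hb⟩ := hv (g₀⁻¹ * n * g₀) (inv_mul_mul_mem_ker_unitsHom g₀ hn)
  refine ⟨b, ?_⟩
  have e : r n * r g₀ = r g₀ * r (g₀⁻¹ * n * g₀) := by
    rw [← map_mul, ← map_mul]; congr 1; group
  rw [Matrix.mulVec_mulVec, ← Matrix.GeneralLinearGroup.coe_mul, e,
    Matrix.GeneralLinearGroup.coe_mul, ← Matrix.mulVec_mulVec, hb, Matrix.mulVec_smul]

/-- If `r` has no common eigenvector, a common eigenvector `v` of `r(ker η)` is moved off its
line by `r(g₀)`, `g₀ ∉ ker η`: otherwise `v` is an eigenvector of every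
`r(g) = r(g₀) r(g₀⁻¹ g)`, `g ∉ ker η` (`g₀⁻¹ g ∈ ker η`, index two). [folklore] -/
theorem mulVec_ne_smul_of_trace_eq_mul (h2 : (2 : k) ≠ 0) {r : Γ →* GL (Fin 2) k}
    {η : Γ →* kˣ}
    (htr : ∀ g, (r g).val.trace = (η g : k) * (r g).val.trace)
    (hce : ¬ HasCommonEigenvector r) {v : Fin 2 → k} (hv0 : v ≠ 0)
    (hv : ∀ n ∈ η.ker, ∃ a : k, (r n).val *ᵥ v = a • v) {g₀ : Γ}
    (hg₀ : g₀ ∉ η.ker) (c : k) : (r g₀).val *ᵥ v ≠ c • v := by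
  intro hc
  refine hce ⟨v, hv0, fun g => ?_⟩
  by_cases hg : g ∈ η.ker
  · exact hv g hg
  · have hmem : g₀⁻¹ * g ∈ η.ker :=
      mul_mem_ker_of_trace_eq_mul h2 htr (fun h => hg₀ (by simpa using η.ker.inv_mem h)) hg
    obtain ⟨a, ha⟩ := hv _ hmem
    refine ⟨a * c, ?_⟩
    have e : r g = r g₀ * r (g₀⁻¹ * g) := by rw [← map_mul, mul_inv_cancel_left]
    rw [e, Matrix.GeneralLinearGroup.coe_mul, ← Matrix.mulVec_mulVec, ha, Matrix.mulVec_smul, hc,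
      smul_smul]

/-- Two vectors of `k²`, the first non-zero and the second not on its line, have non-zero
`2 × 2` determinant `v₀ w₁ - w₀ v₁`. [folklore] -/
theorem fin_two_sub_ne_zero_of_ne_smul {v w : Fin 2 → k} (hv : v ≠ 0) (hw : ∀ c : k, w ≠ c • v) :
    v 0 * w 1 - w 0 * v 1 ≠ 0 := by
  intro h
  by_cases h0 : v 0 = 0
  · have h1 : v 1 ≠ 0 := by
      intro h1; apply hv; ext i; fin_cases i <;> assumption
    have hw0 : w 0 = 0 := by
      rw [h0, zero_mul, zero_sub, neg_eq_zero] at h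
      exact (mul_eq_zero.mp h).resolve_right h1
    apply hw (w 1 / v 1)
    ext i; fin_cases i
    · simp [hw0, h0]
    · simp [div_mul_cancel₀ _ h1]
  · apply hw (w 0 / v 0)
    ext i; fin_cases i
    · simp [div_mul_cancel₀ _ h0]
    · simp only [Pi.smul_apply, smul_eq_mul, Fin.mk_one]
      field_simp
      linear_combination h

/-- **Change of basis, one column at a time.**  If `X` maps the `j`-th column of an invertible
`B` to `a` times its `j'`-th column, then the `j`-th column of `B⁻¹ X B` is `a e_{j'}`:
`(B⁻¹ X B)_{i j} = a δ_{i j'}`. [folklore] -/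
theorem units_inv_mul_mul_apply_of_mulVec_eq (B : GL (Fin 2) k) (X : Matrix (Fin 2) (Fin 2) k)
    {j j' : Fin 2} {a : k} (h : X *ᵥ (fun i => B.val i j) = a • (fun i => B.val i j'))
    (i : Fin 2) :
    ((B⁻¹).val * X * B.val) i j = if i = j' then a else 0 := by
  have hcol : ∀ l, (fun i => B.val i l) = B.val *ᵥ Pi.single l 1 := fun l => by
    rw [Matrix.mulVec_single_one]; rfl
  have key : ((B⁻¹).val * X * B.val) *ᵥ Pi.single j 1 =
      a • Pi.single j' 1 := by
    rw [← Matrix.mulVec_mulVec, ← Matrix.mulVec_mulVec, ← hcol j, h, Matrix.mulVec_smul, hcol j',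
      Matrix.mulVec_mulVec, ← Matrix.GeneralLinearGroup.coe_mul, inv_mul_cancel,
      Matrix.GeneralLinearGroup.coe_one, Matrix.one_mulVec]
  have key' := congrFun key i
  rw [Matrix.mulVec_single_one] at key'
  change _ = a * (Pi.single j' (1 : k) : Fin 2 → k) i at key'
  rw [Pi.single_apply, mul_ite, mul_one, mul_zero] at key'
  exact key'

/-- **Monomial normal form.**  Let `k` be algebraically closed with `2 ≠ 0`, `r : Γ → GL₂(k)`
without common eigenvector, `η : Γ → kˣ` with `tr r = η · tr r` pointwise and `g₀ ∉ ker η`.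
Then for some `P ∈ GL₂(k)` every `P r(n) P⁻¹`, `n ∈ ker η`, is diagonal and every `P r(g) P⁻¹`,
`g ∉ ker η`, is antidiagonal: take the basis `(v, r(g₀) v)` for a common eigenvector `v` of
`r(ker η)` (`exists_common_eigenvector_ker_of_trace_eq_mul`,
`exists_mulVec_mulVec_eq_smul_of_forall_mem_ker`,
`mulVec_ne_smul_of_trace_eq_mul`); for `g ∉ ker η`, `r(g) v = r(g₀) r(g₀⁻¹ g) v` is a
multiple of `r(g₀) v` and `r(g) r(g₀) v = r(g g₀) v` a multiple of `v` (`g₀⁻¹ g, g g₀ ∈ ker η`).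
This is "`ρ ≅ ρ ⊗ η`, `η ≠ 1` quadratic ⟹ `ρ ≅ Ind θ` from `ker η`" in matrix form
(Gelbart 1997, §4.3, Prop. (ii): dihedral type = monomial).
[cite: Gelbart1997, §4.3, Proposition (ii)] -/
theorem exists_conjGL_isDg_isAd_of_trace_eq_mul [IsAlgClosed k] (h2 : (2 : k) ≠ 0)
    {r : Γ →* GL (Fin 2) k}
    {η : Γ →* kˣ}
    (htr : ∀ g, (r g).val.trace = (η g : k) * (r g).val.trace)
    (hce : ¬ HasCommonEigenvector r) {g₀ : Γ} (hg₀ : g₀ ∉ η.ker) :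
    ∃ P : GL (Fin 2) k,
      (∀ g, g ∈ η.ker → GL2.IsDg (conjGL P r g).val) ∧
      (∀ g, g ∉ η.ker → GL2.IsAd (conjGL P r g).val) := by
  obtain ⟨v, hv0, hv⟩ := exists_common_eigenvector_ker_of_trace_eq_mul h2 htr hg₀
  set w : Fin 2 → k := (r g₀).val *ᵥ v with hw
  have hw' : ∀ n ∈ η.ker, ∃ b : k, (r n).val *ᵥ w = b • w := fun n hn =>
    exists_mulVec_mulVec_eq_smul_of_forall_mem_ker hv g₀ hn
  have hind : ∀ c : k, w ≠ c • v :=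
    mulVec_ne_smul_of_trace_eq_mul h2 htr hce hv0 hv hg₀
  have hdet : (Matrix.of fun i j => ![v, w] j i).det ≠ 0 := by
    rw [Matrix.det_fin_two]
    simpa using fin_two_sub_ne_zero_of_ne_smul hv0 hind
  set B := Matrix.GeneralLinearGroup.mkOfDetNeZero _ hdet with hB
  have hc0 : (fun i => B.val i 0) = v := by funext i; rfl
  have hc1 : (fun i => B.val i 1) = w := by funext i; rfl
  have e : ∀ g, (conjGL B⁻¹ r g).val =
      (B⁻¹).val * (r g).val * B.val := fun g => by
    rw [conjGL_apply, inv_inv, Matrix.GeneralLinearGroup.coe_mul, Matrix.GeneralLinearGroup.coe_mul]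
  refine ⟨B⁻¹, fun g hg => ?_, fun g hg => ?_⟩
  · obtain ⟨a, ha⟩ := hv g hg
    obtain ⟨b, hb⟩ := hw' g hg
    rw [e]
    constructor
    · rw [units_inv_mul_mul_apply_of_mulVec_eq B _ (j := 1) (j' := 1) (a := b) (by rw [hc1, hb])]
      simp
    · rw [units_inv_mul_mul_apply_of_mulVec_eq B _ (j := 0) (j' := 0) (a := a) (by rw [hc0, ha])]
      simp
  · have hmem : g₀⁻¹ * g ∈ η.ker :=
      mul_mem_ker_of_trace_eq_mul h2 htr (fun h => hg₀ (by simpa using η.ker.inv_mem h)) hg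
    obtain ⟨a, ha⟩ := hv _ hmem
    have h1 : (r g).val *ᵥ v = a • w := by
      have e' : r g = r g₀ * r (g₀⁻¹ * g) := by rw [← map_mul, mul_inv_cancel_left]
      rw [e', Matrix.GeneralLinearGroup.coe_mul, ← Matrix.mulVec_mulVec, ha, Matrix.mulVec_smul]
    obtain ⟨c, hc⟩ := hv (g * g₀) (mul_mem_ker_of_trace_eq_mul h2 htr hg hg₀)
    have h2' : (r g).val *ᵥ w = c • v := by
      rw [hw, Matrix.mulVec_mulVec, ← Matrix.GeneralLinearGroup.coe_mul, ← map_mul, hc]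
    rw [e]
    constructor
    · rw [units_inv_mul_mul_apply_of_mulVec_eq B _ (j := 0) (j' := 1) (a := a)
        (by rw [hc0, hc1, h1])]
      simp
    · rw [units_inv_mul_mul_apply_of_mulVec_eq B _ (j := 1) (j' := 0) (a := c)
        (by rw [hc1, hc0, h2'])]
      simp

/-- A non-trivial character has an element outside its kernel. [folklore] -/
theorem exists_not_mem_ker_of_ne_one {η : Γ →* kˣ} (hη : η ≠ 1) : ∃ g, g ∉ η.ker := by
  by_contra h
  push Not at h
  exact hη (MonoidHom.ext fun g => (MonoidHom.mem_ker).mp (h g))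

end Literature.NumberTheory.GaloisRepresentations

end
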